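import Summits.CriticalPhenomena.SAWScalingLimit.Theorems.SAWLoopFugacityFlowAvoidanceLimitAnchorDefs
import Summits.CriticalPhenomena.SAWScalingLimit.Theorems.SAWLoopFugacityFlowAvoidanceLimitSawEndpoint
import Literature.Probability.RandomPlanarGeometry.SAWScalingLimitFamily
import Literature.Probability.RandomPlanarGeometry.SelfAvoidingWalkProofs

/-!
# Corner identification — stub `stub_cornerIdentification` of line `saw-corner-germ`
(crux `SAWLoopFugacityFlow.AvoidanceLimit`, stmt-CriticalPhenomena-10649)

The crux asserts that the critical-SAW probability `P_δ(range γ_δ ⊆ closure D')` converges to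
`Φ'_A(0)^{5/8}`. The line `saw-corner-germ` reaches it as the `n = 0` corner of the loop-dressed SAW
family, whose doubly normalised two-leg ratio is `Rδ n t x Ω S δ a b`
(`Theorems/SAWLoopFugacityFlowAvoidanceLimitAnchorDefs`; numerator on the CONFINED graph — the edges
of `Ω_δ` whose closed segment lies in `closure S`). This file proves the lattice identification of
the crux's probability with `R_δ(0, 0, x_c; D, D')` along any endpoint approximation `(a_δ, b_δ)` of a
Dobrushin domain `(D; a, b)`:

`P_δ(range γ_δ ⊆ closure D').toReal - R_δ(0, 0, x_c; D, D') → 0` as `δ → 0⁺`.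

In fact the difference is EVENTUALLY ZERO: along an endpoint approximation the mesh points
`δ a_δ → D.pt 0 ≠ D.pt 1 ← δ b_δ`, so `a_δ ≠ b_δ` for all small `δ > 0` (`eventually_pos_ne`), and for
such `δ` the two quantities are equal by the landed identity `Anchor.stub_sawEndpoint`
(`P = ofReal R`) together with `R ≥ 0` (`Anchor.Rδ_zero_zero_eq_div`: a ratio of sums of powers of
`x_c > 0`, `SAW.criticalFugacity_pos_lt_one'`).

Sources: H. Duminil-Copin, S. Smirnov, Ann. of Math. 175 (2012), §4 (the measure `P_{x,δ}`)
[DuminilCopinSmirnov2012]; N. Madras, G. Slade, *The Self-Avoiding Walk* (1993), §1.2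
[MadrasSlade1993]. No new definitions; nothing about `n ≠ 0` is asserted here.
-/

noncomputable section

open Set Filter Topology MeasureTheory
open Literature.Probability.RandomPlanarGeometry Literature.Probability.LatticeModels
open Summit.CriticalPhenomena.SAWScalingLimit.Theorems.AvoidanceLimit.Anchor

namespace Summit.CriticalPhenomena.SAWScalingLimit.Theorems.AvoidanceLimit.Corner

/-- Along an endpoint approximation of a Dobrushin domain, eventually (as `δ → 0⁺`) the mesh is
positive and the two lattice endpoints are distinct: their mesh points converge to the two distinct
marked points `D.pt 0 ≠ D.pt 1`. [folklore] -/
theorem eventually_pos_ne {D : DobrushinDomain} {a b : ℝ → Site 2}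
    (hab : SAW.IsEndpointApprox D a b) : ∀ᶠ δ in 𝓝[>] (0 : ℝ), 0 < δ ∧ a δ ≠ b δ := by
  have h0 : ∀ᶠ δ in 𝓝[>] (0 : ℝ), 0 < δ := eventually_mem_nhdsWithin
  have hpq : D.pt 0 ≠ D.pt 1 := fun h => absurd (D.pt_injective h) (by decide)
  have hr : 0 < dist (D.pt 0) (D.pt 1) / 2 := by
    have := dist_pos.2 hpq
    positivity
  have ha := (Metric.tendsto_nhds.1 hab.tendsto_fst) _ hr
  have hb := (Metric.tendsto_nhds.1 hab.tendsto_snd) _ hr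
  filter_upwards [h0, ha, hb] with δ hδ hδa hδb
  refine ⟨hδ, fun heq => ?_⟩
  rw [heq, dist_comm] at hδa
  have h3 := dist_triangle (D.pt 0) (meshPoint δ (b δ)) (D.pt 1)
  linarith

/-- `R_δ(0, 0, x_c; Ω, S) ≥ 0` between distinct lattice points: by `Anchor.Rδ_zero_zero_eq_div` it is
the ratio of the SAW generating functions (at `x_c = 1/μ > 0`) of the confined graph and of `Ω_δ`,
both sums of nonnegative terms (and Lean's `x / 0 = 0 ≥ 0` in the junk case).
[cite: MadrasSlade1993, §1.2] -/
theorem Rδ_zero_zero_criticalFugacity_nonneg (Ω S : Set ℂ) (δ : ℝ) {a b : Site 2} (hab : a ≠ b) :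
    0 ≤ Rδ (0 : ℝ) 0 SAW.criticalFugacity Ω S δ a b := by
  rw [Rδ_zero_zero_eq_div _ Ω S δ hab]
  have hx : 0 ≤ SAW.criticalFugacity := SAW.criticalFugacity_pos_lt_one'.1.le
  exact div_nonneg (Finset.sum_nonneg fun p _ => pow_nonneg hx _)
    (Finset.sum_nonneg fun p _ => pow_nonneg hx _)

/-- For a Dobrushin domain `D`, any `S ⊆ ℂ`, `δ > 0` and distinct lattice points `a ≠ b`, the
critical-SAW probability that the polyline stays in `closure S`, read as a real number, IS the ratio
`R_δ(0, 0, x_c; D, S)` (the landed `Anchor.stub_sawEndpoint`, `P = ofReal R`, unwrapped with `R ≥ 0`).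
[cite: DuminilCopinSmirnov2012, §4 (before Conjecture 1)] -/
theorem toReal_map_law_rangeSubset_eq (D : DobrushinDomain) (S : Set ℂ) {δ : ℝ} (hδ : 0 < δ)
    {a b : Site 2} (hab : a ≠ b) :
    (((SAW.law D.carrier δ a b).map (fun γ => γ.curve)) (CurveClass.rangeSubset (closure S))).toReal =
      Rδ (0 : ℝ) 0 SAW.criticalFugacity D.carrier S δ a b := by
  rw [stub_sawEndpoint D.carrier S δ a b D.isBounded hδ hab,
    ENNReal.toReal_ofReal (Rδ_zero_zero_criticalFugacity_nonneg _ _ _ hab)]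

/-- **Corner identification** (stub `stub_cornerIdentification` of line `saw-corner-germ`): along an
endpoint approximation `(a_δ, b_δ)` of a Dobrushin domain `(D; a, b)` and for every Dobrushin domain
`D'`, `P_δ(range γ_δ ⊆ closure D').toReal - R_δ(0, 0, x_c; D, D') → 0` as `δ → 0⁺`. The difference is
eventually `0`: for all small `δ > 0` one has `a_δ ≠ b_δ` (`eventually_pos_ne`) and then the two terms
are equal (`toReal_map_law_rangeSubset_eq`, i.e. the landed `Anchor.stub_sawEndpoint`).
[cite: DuminilCopinSmirnov2012, §4 (before Conjecture 1)] -/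
theorem stub_cornerIdentification :
    ∀ (D D' : DobrushinDomain) (a b : ℝ → Site 2), SAW.IsEndpointApprox D a b →
      Tendsto (fun δ => (((SAW.law D.carrier δ (a δ) (b δ)).map (fun γ => γ.curve))
          (CurveClass.rangeSubset (closure D'.carrier))).toReal -
        Rδ (0 : ℝ) 0 SAW.criticalFugacity D.carrier D'.carrier δ (a δ) (b δ)) (𝓝[>] 0) (𝓝 0) := by
  intro D D' a b hab
  refine tendsto_const_nhds.congr' ?_
  filter_upwards [eventually_pos_ne hab] with δ hδ
  rw [toReal_map_law_rangeSubset_eq D D'.carrier hδ.1 hδ.2, sub_self]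

end Summit.CriticalPhenomena.SAWScalingLimit.Theorems.AvoidanceLimit.Corner

end
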